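import Summits.Langlands.Langlands.Theses.QuarterDeficit1951
import Literature.NumberTheory.GaloisRepresentations.GaloisRepUnramifiedProofs
import Literature.NumberTheory.GaloisRepresentations.TateUnramifiedLiftingHolds
import Literature.NumberTheory.GaloisRepresentations.DirichletCharacterOfGaloisCharacter
import Literature.FieldTheory.AlgClosed.PadicAlgClEquivComplex
import Literature.NumberTheory.Automorphic.BCDTTheoremBWildAtThreeDet
import Literature.NumberTheory.GaloisRepresentations.GaloisRepFrobeniusProofs

/-!
# Route `QuarterDeficit1951` (Langlands) — crux `IcosahedralSupply`: stub `stub_frobeniusReadout`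

For a continuous `ρ : Γ_ℚ → GL₂(k)` with open kernel, unramified away from the place `v₀` of `ℚ`
above `1951`, whose inertia group at a prime `𝔓 ∣ v₀` of `ℤ̄` acts as `P · diag(1, η) · P⁻¹` with
`η` non-trivial and `η⁵ = 1`, and a ring homomorphism `ι : k →+* ℂ`:

* (i) the character `ψ = ι ∘ det ρ : Γ_ℚ → ℂˣ` has open kernel, is unramified away from `v₀`,
  and on `I_𝔓` takes values in `μ₅` with a non-trivial value.  By the Kronecker–Weber dictionary of
  the tree (`exists_isPrimitive_dirichletCharacter_eq_dirichletGaloisCharacter`) it is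
  `σ ↦ χ(χ_N(σ))` for a primitive Dirichlet character `χ` of some level `N`; ramification is read
  off the level (`not_dvd_level_of_isPrimitive_of_forall_mem_inertia`), so `N = 1951^(a+1)`;
  inertia at `1951` surjects onto `(ℤ/N)ˣ` through `χ_N` (`exists_mem_inertia_modNCyclotomicCharacter_eq`),
  so `χ` takes values in `μ₅` on units, hence kills the kernel of `(ℤ/1951^(a+1))ˣ → (ℤ/1951)ˣ`
  (a `1951`-group) and factors through a character `χ₁` mod `1951` with `χ₁⁵ = 1`, `χ₁ ≠ 1`;
  at an arithmetic Frobenius `σ₀` at `v ≠ v₀`, `ψ(σ₀) = χ₁(N v)`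
  (`modNCyclotomicCharacter_eq_residueCard_of_isArithFrobAt`), and `χ₀ := χ₁⁻¹` has order `5`
  with `ι(det ρ(σ₀)) = χ₀(N v)⁻¹`;
* (ii) at `v ≠ v₀` all arithmetic Frobenii share the characteristic polynomial
  `X² − tr ρ(σ₀) X + det ρ(σ₀)` (tree `GaloisRep.IsUnramifiedAt.hasFrobCharpolyAt_charpoly`,
  Mathlib `Matrix.charpoly_fin_two`).
-/

set_option linter.dupNamespace false

noncomputable section

open scoped NumberField MatrixGroups
open Field IsDedekindDomain Polynomial
open Literature.NumberTheory.GaloisRepresentations Literature.NumberTheory.PAdicHodge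

namespace Summit.Langlands.Langlands.Theorems.QuarterDeficit1951

/-! ## Frobenius characteristic polynomials at unramified places -/

/-- At a place `v` where the framed representation `ρ : Γ_ℚ → GL₂(k)` is unramified, every
arithmetic Frobenius at every prime above `v` has characteristic polynomial
`X² − tr ρ(σ₀) · X + det ρ(σ₀)` for any one arithmetic Frobenius `σ₀` at any one prime `𝔓₀ ∣ v`
(Frobenii are conjugate up to inertia and the characteristic polynomial is a class function,
tree `GaloisRep.IsUnramifiedAt.hasFrobCharpolyAt_charpoly`; `2 × 2` characteristic polynomial,
Mathlib `Matrix.charpoly_fin_two`). [folklore] -/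
theorem hasFrobCharpolyAt_traceDet_of_isUnramifiedAt {k : Type} [Field k] [TopologicalSpace k]
    [IsTopologicalRing k] (ρ : FramedGaloisRep ℚ k 2) {v : HeightOneSpectrum (𝓞 ℚ)}
    (hv : ρ.IsUnramifiedAt v) {𝔓₀ : Ideal (absIntegers (𝓞 ℚ) ℚ)} (h𝔓₀ : 𝔓₀ ∈ v.primesAbove)
    {σ₀ : absoluteGaloisGroup ℚ} (hσ₀ : IsArithFrobAt (𝓞 ℚ) σ₀ 𝔓₀) :
    ρ.HasFrobCharpolyAt v
      (X ^ 2 - C (((ρ σ₀ : GL (Fin 2) k) : Matrix (Fin 2) (Fin 2) k).trace) * X +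
        C (((ρ σ₀ : GL (Fin 2) k) : Matrix (Fin 2) (Fin 2) k).det)) := by
  have hU := (FramedGaloisRep.isUnramifiedAt_toGaloisRep_iff v ρ).2 hv
  have hP := (FramedGaloisRep.hasFrobCharpolyAt_toGaloisRep_iff v _ ρ).1
    (hU.hasFrobCharpolyAt_charpoly h𝔓₀ hσ₀)
  have heq := hP 𝔓₀ h𝔓₀ σ₀ hσ₀
  rw [← heq] at hP
  rw [← Matrix.charpoly_fin_two]
  exact hP

/-! ## The determinant on inertia -/

/-- The determinant of `P · diag(1, e) · P⁻¹` is `e`. [folklore] -/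
theorem det_eq_of_eq_conj_diagonal {k : Type} [Field k] (P : GL (Fin 2) k)
    {M : Matrix (Fin 2) (Fin 2) k} {e : k}
    (hM : M = (P : Matrix (Fin 2) (Fin 2) k) * Matrix.diagonal ![(1 : k), e] *
      ((P⁻¹ : GL (Fin 2) k) : Matrix (Fin 2) (Fin 2) k)) :
    M.det = e := by
  have hPdet : (P : Matrix (Fin 2) (Fin 2) k).det *
      ((P⁻¹ : GL (Fin 2) k) : Matrix (Fin 2) (Fin 2) k).det = 1 := by
    rw [← Matrix.det_mul, ← Units.val_mul, mul_inv_cancel, Units.val_one, Matrix.det_one]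
  rw [hM, Matrix.det_mul, Matrix.det_mul, mul_right_comm, hPdet, one_mul, Matrix.det_diagonal,
    Fin.prod_univ_two]
  simp

/-! ## Characters of `Γ_ℚ` ramified only at `p`, tamely, are Dirichlet characters mod `p` -/

/-- The kernel of the reduction `(ℤ/p^(a+1))ˣ → (ℤ/p)ˣ` is a `p`-group of order `p^a`
(the reduction is onto, Mathlib `ZMod.unitsMap_surjective`, and `#(ℤ/p^(n+1))ˣ = p^n (p − 1)`),
so each of its elements is killed by `p^a`. [folklore] -/
theorem pow_eq_one_of_unitsMap_eq_one {p : ℕ} (hp : p.Prime) (a : ℕ)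
    {x : (ZMod (p ^ (a + 1)))ˣ} (hx : ZMod.unitsMap (dvd_pow_self p a.succ_ne_zero) x = 1) :
    x ^ p ^ a = 1 := by
  haveI : NeZero (p ^ (a + 1)) := ⟨pow_ne_zero _ hp.ne_zero⟩
  haveI : NeZero p := ⟨hp.ne_zero⟩
  set φ : (ZMod (p ^ (a + 1)))ˣ →* (ZMod p)ˣ := ZMod.unitsMap (dvd_pow_self p a.succ_ne_zero)
    with hφ
  have hcard : Nat.card φ.ker = p ^ a := by
    have h1 : Nat.card φ.ker * φ.ker.index = Nat.card (ZMod (p ^ (a + 1)))ˣ :=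
      φ.ker.card_mul_index
    rw [Subgroup.index_ker, MonoidHom.range_eq_top.mpr (ZMod.unitsMap_surjective _),
      Subgroup.card_top, Nat.card_eq_fintype_card (α := (ZMod p)ˣ),
      Nat.card_eq_fintype_card (α := (ZMod (p ^ (a + 1)))ˣ), ZMod.card_units_eq_totient,
      ZMod.card_units_eq_totient, Nat.totient_prime_pow_succ hp, Nat.totient_prime hp] at h1
    have hp1 : 0 < p - 1 := by have := hp.two_le; omega
    exact Nat.eq_of_mul_eq_mul_right hp1 h1
  have hmem : x ∈ φ.ker := hx
  have h2 : (⟨x, hmem⟩ : φ.ker) ^ Nat.card φ.ker = 1 := pow_card_eq_one'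
  rw [hcard] at h2
  exact congrArg Subtype.val h2

/-- **A character of `Γ_ℚ` with open kernel, unramified away from the place of `p` and of finite
order prime to `p` on an inertia group at `p`, is a Dirichlet character mod `p`.**  Let
`ψ : Γ_ℚ → ℂˣ` have open kernel, be trivial on the inertia groups of all primes of `ℤ̄` away from
the place `v₀ ∋ p`, and satisfy `ψ(τ)^r = 1` (`p ∤ r`) for `τ` in the inertia group of one prime
`𝔓 ∣ v₀`, with `ψ(I_𝔓) ≠ 1`.  Then `ψ(σ) = χ(χ_p(σ))` for a Dirichlet character `χ` mod `p` with
`χ^r = 1`, `χ ≠ 1`.  Proof: by Kronecker–Weber `ψ = χ ∘ χ_N` with `χ` primitive of level `N`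
(`exists_isPrimitive_dirichletCharacter_eq_dirichletGaloisCharacter`); every prime `q ≠ p` is
excluded from `N` by unramifiedness (`not_dvd_level_of_isPrimitive_of_forall_mem_inertia`), so
`N = p^(a+1)` (`N = 1` would make `ψ` trivial on `I_𝔓`); `χ_N(I_𝔓) = (ℤ/N)ˣ`
(`exists_mem_inertia_modNCyclotomicCharacter_eq`), so `χ^r = 1` on units, and `χ` kills the
kernel of `(ℤ/p^(a+1))ˣ → (ℤ/p)ˣ`, a `p`-group (`pow_eq_one_of_unitsMap_eq_one`), i.e. factors
through level `p` (Mathlib `DirichletCharacter.factorsThrough_iff_ker_unitsMap`).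
[cite: Washington1997, Ch. 3 (pp. 19–21)] -/
theorem exists_dirichletCharacter_of_ramifiedOnlyAt {p r : ℕ} [NeZero p] (hp : p.Prime)
    (hpr : p.Coprime r) (ψ : absoluteGaloisGroup ℚ →* ℂˣ)
    (hker : IsOpen ((ψ.ker : Subgroup (absoluteGaloisGroup ℚ)) : Set (absoluteGaloisGroup ℚ)))
    {v₀ : HeightOneSpectrum (𝓞 ℚ)} (hv₀ : (p : 𝓞 ℚ) ∈ v₀.asIdeal)
    (hunr : ∀ v : HeightOneSpectrum (𝓞 ℚ), v ≠ v₀ → ∀ 𝔔 ∈ v.primesAbove,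
      ∀ τ ∈ 𝔔.inertia (absoluteGaloisGroup ℚ), ψ τ = 1)
    {𝔓 : Ideal (absIntegers (𝓞 ℚ) ℚ)} (h𝔓 : 𝔓 ∈ v₀.primesAbove)
    (hIr : ∀ τ ∈ 𝔓.inertia (absoluteGaloisGroup ℚ), ψ τ ^ r = 1)
    (hI1 : ∃ τ ∈ 𝔓.inertia (absoluteGaloisGroup ℚ), ψ τ ≠ 1) :
    ∃ χ : DirichletCharacter ℂ p, χ ^ r = 1 ∧ χ ≠ 1 ∧
      ∀ σ : absoluteGaloisGroup ℚ, (ψ σ : ℂ) = χ (modNCyclotomicCharacter ℚ p σ : ZMod p) := by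
  classical
  obtain ⟨τ₀, hτ₀I, hτ₀⟩ := hI1
  -- Kronecker–Weber, with a primitive character `χ` of level `N`
  obtain ⟨N, hN, χ, hprim, hψχ⟩ :=
    exists_isPrimitive_dirichletCharacter_eq_dirichletGaloisCharacter ψ hker
  have hgen : Rat.HeightOneSpectrum.natGenerator v₀ = p :=
    natGenerator_eq_of_natCast_mem_asIdeal hp hv₀
  -- (1) every prime factor of `N` is `p` (`ψ` is unramified away from `v₀`)
  have hqN : ∀ q : ℕ, q.Prime → q ∣ N → q = p := by
    intro q hq hqN
    by_contra hqp
    set w : HeightOneSpectrum (𝓞 ℚ) :=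
      (Rat.HeightOneSpectrum.primesEquiv (R := 𝓞 ℚ)).symm ⟨q, hq⟩ with hw
    have hwq : (q : 𝓞 ℚ) ∈ w.asIdeal :=
      (Literature.NumberTheory.EllipticCurves.natCast_mem_asIdeal_iff_eq_primesEquiv_symm w hq).mpr
        rfl
    have hwv : w ≠ v₀ := by
      intro h
      rw [h] at hwq
      exact hqp ((natGenerator_eq_of_natCast_mem_asIdeal hq hwq).symm.trans hgen)
    obtain ⟨𝔔, h𝔔⟩ := HeightOneSpectrum.primesAbove_nonempty w
    have hψ' : ∀ τ ∈ 𝔔.inertia (absoluteGaloisGroup ℚ),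
        ((dirichletGaloisCharacter ℚ χ τ : ℂˣ) : ℂ) = 1 := fun τ hτ => by
      rw [← hψχ τ, hunr w hwv 𝔔 h𝔔 τ hτ, Units.val_one]
    exact not_dvd_level_of_isPrimitive_of_forall_mem_inertia hprim hq hwq h𝔔 hψ' hqN
  -- (2) so `N = p ^ e`
  obtain ⟨e, d, hd, hNe⟩ := Nat.exists_eq_pow_mul_and_not_dvd (NeZero.ne N) p hp.ne_one
  have hd1 : d = 1 := by
    by_contra hd1
    have hq := hqN _ (Nat.minFac_prime hd1) ((Nat.minFac_dvd d).trans (Dvd.intro_left _ hNe.symm))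
    exact hd (hq ▸ Nat.minFac_dvd d)
  rw [hd1, mul_one] at hNe
  -- (3) `e ≠ 0`: otherwise `χ = 1` and `ψ = 1` on `I_𝔓`
  have he : e ≠ 0 := by
    rintro rfl
    rw [pow_zero] at hNe
    apply hτ₀
    have h2 := hψχ τ₀
    rw [coe_dirichletGaloisCharacter_apply, DirichletCharacter.level_one' χ hNe,
      MulChar.one_apply_coe] at h2
    exact Units.val_eq_one.mp h2
  obtain ⟨a, rfl⟩ : ∃ a, e = a + 1 := ⟨e - 1, by omega⟩
  subst hNe
  haveI : Fact p.Prime := ⟨hp⟩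
  -- (4) inertia at `p` surjects onto `(ℤ/p^(a+1))ˣ` through `χ_{p^(a+1)}`: `χ(u)^r = 1` for all `u`
  have hχu : ∀ u : (ZMod (p ^ (a + 1)))ˣ, ∃ τ ∈ 𝔓.inertia (absoluteGaloisGroup ℚ),
      χ u = ψ τ := by
    intro u
    obtain ⟨τ, hτ, hτu⟩ := exists_mem_inertia_modNCyclotomicCharacter_eq (m := p ^ (a + 1))
      (p := p) (k := a) (d := 1) (mul_one _).symm (fun h1 => hp.ne_one (Nat.dvd_one.mp h1)) hgen
      h𝔓 (a := u) (Subsingleton.elim _ _)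
    exact ⟨τ, hτ, by rw [hψχ τ, coe_dirichletGaloisCharacter_apply, hτu]⟩
  have hχr : ∀ u : (ZMod (p ^ (a + 1)))ˣ, χ u ^ r = 1 := by
    intro u
    obtain ⟨τ, hτ, hu⟩ := hχu u
    rw [hu, ← Units.val_pow_eq_pow_val, hIr τ hτ, Units.val_one]
  -- (5) `χ` factors through `p`: the kernel of `(ℤ/p^(a+1))ˣ → (ℤ/p)ˣ` is killed by `p^a`
  have hdvd : p ∣ p ^ (a + 1) := dvd_pow_self p a.succ_ne_zero
  have hfac : χ.FactorsThrough p := by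
    rw [DirichletCharacter.factorsThrough_iff_ker_unitsMap hdvd]
    intro x hx
    rw [MonoidHom.mem_ker] at hx ⊢
    have h1 : χ.toUnitHom x ^ p ^ a = 1 := by
      rw [← map_pow, pow_eq_one_of_unitsMap_eq_one hp a hx, map_one]
    have h2 : χ.toUnitHom x ^ r = 1 := by
      ext
      rw [Units.val_pow_eq_pow_val, MulChar.coe_toUnitHom, hχr x, Units.val_one]
    have h3 := pow_gcd_eq_one.mpr ⟨h1, h2⟩
    rwa [Nat.Coprime.gcd_eq_one (hpr.pow_left a), pow_one] at h3
  obtain ⟨_, χ₁, rfl⟩ := hfac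
  have hχ₁u : ∀ u' : (ZMod (p ^ (a + 1)))ˣ,
      χ₁ (ZMod.unitsMap hdvd u' : (ZMod p)ˣ) = DirichletCharacter.changeLevel hdvd χ₁ u' := by
    intro u'
    rw [← MulChar.coe_toUnitHom, ← MulChar.coe_toUnitHom,
      DirichletCharacter.changeLevel_toUnitHom, MonoidHom.comp_apply]
  refine ⟨χ₁, ?_, ?_, fun σ => ?_⟩
  · ext u
    obtain ⟨u', rfl⟩ := ZMod.unitsMap_surjective hdvd u
    rw [MulChar.pow_apply_coe, MulChar.one_apply_coe, hχ₁u, hχr]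
  · intro h1
    apply hτ₀
    have h2 := hψχ τ₀
    rw [dirichletGaloisCharacter_changeLevel, coe_dirichletGaloisCharacter_apply, h1,
      MulChar.one_apply_coe] at h2
    exact Units.val_eq_one.mp h2
  · rw [hψχ σ, dirichletGaloisCharacter_changeLevel, coe_dirichletGaloisCharacter_apply]

/-! ## The stub -/

/-- **Stub (Frobenius read-out).** For `ρ : Γ_ℚ → GL₂(k)` with open kernel, unramified away from
the place `v₀` above `1951`, with inertia above `v₀` acting as `P · diag(1, η) · P⁻¹`, `η` non-trivial
with `η⁵ = 1`: (i) the determinant, moved to `ℂ` along `ι`, is at every arithmetic Frobenius away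
from `v₀` the INVERSE of the value at `N v` of one Dirichlet character `χ₀` mod `1951` of order `5`
(Kronecker–Weber dictionary `exists_isPrimitive_dirichletCharacter_of_isOpen_ker`; the conductor is
`1951` because `χ₀` is unramified away from `1951` and has order prime to `1951`; the order is `5`
because inertia at `1951` surjects onto `Gal(ℚ(ζ_{1951})/ℚ)`); (ii) at every `v ≠ v₀` the arithmetic
Frobenii have a common characteristic polynomial `X² − tX + d`, with `(t, d)` the trace and
determinant of `ρ` at one of them. [cite: Washington1997, Ch. 3 (pp. 19–21)] -/
theorem stub_frobeniusReadout (k : Type) [Field k] [CharZero k] [TopologicalSpace k]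
    [IsTopologicalRing k] [T2Space k] (ρ : FramedGaloisRep ℚ k 2)
    (hker : IsOpen ((ρ.toMonoidHom.ker : Subgroup (absoluteGaloisGroup ℚ)) :
      Set (absoluteGaloisGroup ℚ)))
    (ι : k →+* ℂ) (v₀ : HeightOneSpectrum (𝓞 ℚ)) (hv₀ : ((1951 : ℕ) : 𝓞 ℚ) ∈ v₀.asIdeal)
    (hunr : ∀ v : HeightOneSpectrum (𝓞 ℚ), v ≠ v₀ → ρ.IsUnramifiedAt v)
    (hshape : ∃ 𝔓 ∈ v₀.primesAbove, ∃ (P : GL (Fin 2) k)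
        (η : 𝔓.inertia (absoluteGaloisGroup ℚ) →* kˣ),
        (∀ τ : 𝔓.inertia (absoluteGaloisGroup ℚ),
          ((ρ (τ : absoluteGaloisGroup ℚ) : GL (Fin 2) k) : Matrix (Fin 2) (Fin 2) k) =
            (P : Matrix (Fin 2) (Fin 2) k) * Matrix.diagonal ![(1 : k), (η τ : k)] *
              ((P⁻¹ : GL (Fin 2) k) : Matrix (Fin 2) (Fin 2) k)) ∧
        (∃ τ, η τ ≠ 1) ∧ (∀ τ, η τ ^ 5 = 1)) :
    ∃ χ₀ : DirichletCharacter ℂ 1951, orderOf χ₀ = 5 ∧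
      ∀ v : HeightOneSpectrum (𝓞 ℚ), v ≠ v₀ →
        ∃ (𝔓₀ : Ideal (absIntegers (𝓞 ℚ) ℚ)) (σ₀ : absoluteGaloisGroup ℚ),
          𝔓₀ ∈ v.primesAbove ∧ IsArithFrobAt (𝓞 ℚ) σ₀ 𝔓₀ ∧
          ρ.HasFrobCharpolyAt v
            (X ^ 2 - C (((ρ σ₀ : GL (Fin 2) k) : Matrix (Fin 2) (Fin 2) k).trace) * X +
              C (((ρ σ₀ : GL (Fin 2) k) : Matrix (Fin 2) (Fin 2) k).det)) ∧
          ι (((ρ σ₀ : GL (Fin 2) k) : Matrix (Fin 2) (Fin 2) k).det) =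
            (χ₀ (v.residueCard : ZMod 1951))⁻¹ := by
  classical
  have hp : Nat.Prime 1951 := by norm_num
  -- the determinant character read in `ℂ` through `ι`
  set ψ : absoluteGaloisGroup ℚ →* ℂˣ :=
    (Units.map (ι : k →* ℂ)).comp (Matrix.GeneralLinearGroup.det.comp ρ.toMonoidHom) with hψdef
  have hψ : ∀ σ, (ψ σ : ℂ) = ι (((ρ σ : GL (Fin 2) k) : Matrix (Fin 2) (Fin 2) k).det) :=
    fun σ => rfl
  have hψρ : ∀ σ, ρ σ = 1 → ψ σ = 1 := fun σ hσ => by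
    change Units.map (ι : k →* ℂ) (Matrix.GeneralLinearGroup.det (ρ σ)) = 1
    rw [hσ, map_one, map_one]
  have hψker : IsOpen ((ψ.ker : Subgroup (absoluteGaloisGroup ℚ)) : Set (absoluteGaloisGroup ℚ)) :=
    Subgroup.isOpen_mono (fun σ hσ => hψρ σ hσ) hker
  -- `ψ` is unramified away from `v₀`
  have hψunr : ∀ v : HeightOneSpectrum (𝓞 ℚ), v ≠ v₀ → ∀ 𝔔 ∈ v.primesAbove,
      ∀ τ ∈ 𝔔.inertia (absoluteGaloisGroup ℚ), ψ τ = 1 :=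
    fun v hv 𝔔 h𝔔 τ hτ => hψρ τ (hunr v hv 𝔔 h𝔔 τ hτ)
  -- on the inertia group at `v₀`: `ψ = ι ∘ η`, fifth roots of unity, not all trivial
  obtain ⟨𝔓, h𝔓, P, η, hPη, ⟨τ₀, hτ₀⟩, h5⟩ := hshape
  have hψI : ∀ (τ : absoluteGaloisGroup ℚ) (hτ : τ ∈ 𝔓.inertia (absoluteGaloisGroup ℚ)),
      (ψ τ : ℂ) = ι (η ⟨τ, hτ⟩ : k) := fun τ hτ => by
    rw [hψ]
    exact congrArg ι (det_eq_of_eq_conj_diagonal P (hPη ⟨τ, hτ⟩))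
  have hIr : ∀ τ ∈ 𝔓.inertia (absoluteGaloisGroup ℚ), ψ τ ^ 5 = 1 := by
    intro τ hτ
    ext
    rw [Units.val_pow_eq_pow_val, hψI τ hτ, ← map_pow, ← Units.val_pow_eq_pow_val, h5 ⟨τ, hτ⟩,
      Units.val_one, map_one, Units.val_one]
  have hI1 : ∃ τ ∈ 𝔓.inertia (absoluteGaloisGroup ℚ), ψ τ ≠ 1 := by
    refine ⟨τ₀, τ₀.2, fun h => hτ₀ ?_⟩
    have h' := hψI τ₀ τ₀.2
    rw [h, Units.val_one] at h'
    ext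
    rw [Units.val_one]
    exact ι.injective (by rw [map_one]; exact h'.symm)
  -- the Dirichlet character mod `1951`
  obtain ⟨χ, hχ5, hχ1, hψχ⟩ := exists_dirichletCharacter_of_ramifiedOnlyAt hp (by norm_num) ψ
    hψker hv₀ hψunr h𝔓 hIr hI1
  haveI : Fact (Nat.Prime 5) := ⟨by norm_num⟩
  refine ⟨χ⁻¹, ?_, fun v hv => ?_⟩
  · rw [orderOf_inv]
    exact orderOf_eq_prime hχ5 hχ1
  · obtain ⟨𝔓₀, h𝔓₀⟩ := HeightOneSpectrum.primesAbove_nonempty v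
    obtain ⟨σ₀, hσ₀⟩ := HeightOneSpectrum.exists_isArithFrobAt_of_mem_primesAbove_holds h𝔓₀
    refine ⟨𝔓₀, σ₀, h𝔓₀, hσ₀,
      hasFrobCharpolyAt_traceDet_of_isUnramifiedAt ρ (hunr v hv) h𝔓₀ hσ₀, ?_⟩
    -- `v ≠ v₀` lies above a prime `≠ 1951`
    have hv1951 : ¬ ((Rat.HeightOneSpectrum.primesEquiv v : Nat.Primes) : ℕ) ∣ 1951 := by
      intro hdvd
      have hq : ((Rat.HeightOneSpectrum.primesEquiv v : Nat.Primes) : ℕ) = 1951 :=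
        (Nat.prime_dvd_prime_iff_eq (Rat.HeightOneSpectrum.primesEquiv v).2 hp).mp hdvd
      apply hv
      have h1 : Rat.HeightOneSpectrum.primesEquiv v = ⟨1951, hp⟩ := Subtype.ext hq
      rw [← (Rat.HeightOneSpectrum.primesEquiv (R := 𝓞 ℚ)).symm_apply_apply v, h1]
      exact ((Literature.NumberTheory.EllipticCurves.natCast_mem_asIdeal_iff_eq_primesEquiv_symm
        v₀ hp).mp hv₀).symm
    have hN : ((1951 : ℕ) : absIntegers (𝓞 ℚ) ℚ) ∉ 𝔓₀ :=
      Rat.natCast_not_mem_of_mem_primesAbove_of_not_dvd h𝔓₀ hv1951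
    rw [MulChar.inv_apply_eq_inv', inv_inv, ← hψ σ₀, hψχ σ₀,
      modNCyclotomicCharacter_eq_residueCard_of_isArithFrobAt h𝔓₀ hN hσ₀]

end Summit.Langlands.Langlands.Theorems.QuarterDeficit1951

end
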